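import Summits.ResolutionOfSingularities.ResolutionOfSingularities.Theorems.PurelyInseparableDim4Mode0UmbrellaSteps
import HarnessLib

/-!
# C-001 ‖ K: under MODE 0 the residual order of `z² + yw²` rises infinitely often (period `3, 2, 2`)

[OURS · census certificate / negative result about the calibration mode MODE 0 of OUR frame —
nothing about resolution of singularities; counted 0.]  Census cell «res-dim4-pi» (D-0157 DOOR 2),
JUMPS row C-001 / zoo row Z28 (Hauser–Perlega PRIMS 60 §7 Example 2, the Whitney-umbrella cylinder;
desk WORD #25 (e)).  Assembles the three steps of `PurelyInseparableDim4Mode0UmbrellaSteps` into ONE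
infinite chain of point-blow-up edges (`PIDim4.Step0 2`) over every field of characteristic `2`:

`c (3n) = (Pₙ, x ↦ 2aₙ, {x})  ⟶  c (3n+1)` (`y`-chart origin, DROP `3 → 2`)
`⟶ c (3n+2)` (`x`-chart origin, EQUAL) `⟶ c (3n+3) = (Pₙ₊₁, x ↦ 2aₙ₊₁, {x})` (`x`-chart at `y = 1`,
**RISE `2 → 3`**), with `P₀ = yw²`, `a₀ = 0`, `aₙ₊₁ = 3aₙ + 1` (`2aₙ + 1 = 3ⁿ`) and
`Pₙ₊₁ = TC (TB (TA Pₙ))` (`P₁ = x²yw²`, `P₂ = x⁸yw²(1+y)²`, …): the engines' MODE-0 word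
`[y-chart O · x-chart O · x-chart (y = 1)]^∞` from the class root of Z28, letters `d = 3, 2, 2, 3, 2, 2,
…` — «the initial form returns».  So along ONE branch of point blow-ups the letter `d` RISES
INFINITELY OFTEN while staying bounded (`≤ 3`): MODE 0 is calibration-only for a KNOWN reason (the
`2`-fold locus `V(z, w)` is not isolated), and no function of the state that drops on EQUAL/DROP
edges and tolerates these rises can be well-founded along this branch.  (The first state carries the
exceptional label `{x}` with multiplicity `0` instead of the root's `∅`; labels do not enter `Step0` or
the shade.)  Nothing here proves or disproves resolution of singularities in dim ≥ 4 / char p.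
-/

-- house layout `Summits/<Summit>/<Problem>` doubles the namespace component (as in the Target file)
set_option linter.dupNamespace false

noncomputable section

namespace Summit.ResolutionOfSingularities.ResolutionOfSingularities.Theorems.PIDim4

namespace Mode0Umbrella

open MvPolynomial Finset
open Literature.AlgebraicGeometry.Resolution
open Literature.AlgebraicGeometry.Resolution.Hauser2010
open Literature.AlgebraicGeometry.Resolution.CentreBlowup

variable {K : Type} [Field K]

/-! ## 6. The three steps of the model -/

/-- every visited polynomial keeps the factor `w²`: the point of the chart is `2`-fold. [folklore] -/
theorem isEquimultiplePoint_of_w {j : Fin 4} (hj : j ≠ 2) {b : Fin 4 → K} (hb : b 2 = 0)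
    {s : State K} (hs : ∀ d ∈ s.F.support, d 2 = 2) [DecidableEq K] :
    IsEquimultiplePoint 2 Finset.univ j b s := by
  classical
  intro D _ hD
  by_contra hc
  have hmem : D ∈ (pointTransform 2 Finset.univ j b s).support := MvPolynomial.mem_support_iff.mpr hc
  unfold pointTransform at hmem
  rw [MvPolynomial.mem_support_iff, PointBlowup.translate_eq_sum_support, coeff_sum] at hmem
  obtain ⟨E, hE, hne⟩ := Finset.exists_ne_zero_of_sum_ne_zero hmem
  have hD2 : D 2 = E 2 := PointBlowup.apply_eq_of_coeff_translate_monomial_ne_zero _ hb hne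
  obtain ⟨d, hd, rfl⟩ := exists_of_mem_support_chartTransform hE
  rw [chartExponent_apply_of_ne _ _ hj.symm, hs d hd] at hD2
  have := Finsupp.le_degree 2 D
  omega

/-- **Step 1** (`y`-chart origin): `SA a F ⟶ SB a (TA F)`. [folklore] -/
theorem step_A [DecidableEq K] {a : ℕ} {F : MvPolynomial (Fin 4) K} (h : InvA a F) :
    CentreBlowup.step 2 Finset.univ 1 0 (SA a F) = SB a (TA F) := by
  classical
  have hB := invB_TA h
  have hF : deletePthPowers 2 (pointTransform 2 Finset.univ 1 0 (SA a F)) = TA F := by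
    rw [pointTransform, PointBlowup.translate_eq_self (0 : Fin 4 → K) (fun _ => rfl)]
    exact deletePthPowers_eq_self fun d hd => by
      obtain ⟨i, j, rfl⟩ := hB.1 d hd; rw [isPthPowerExponent_ex_iff]; omega
  have hr : newMult 2 Finset.univ 1 0 (SA a F) =
      Finsupp.single 0 (2 * a) + Finsupp.single 1 (2 * a + 1) := by
    unfold newMult
    rw [show (SA a F).F = F from rfl, ordAlong_A h, ENat.toNat_coe, show (SA a F).r = Finsupp.single 0 (2 * a) from rfl]
    ext i
    rw [Finsupp.update_apply, Finsupp.filter_apply]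
    fin_cases i <;> simp
  have he : newExc 1 0 (SA a F) = ({0, 1} : Finset (Fin 4)) := by
    unfold newExc
    have hf : Finset.filter (fun i => (0 : Fin 4 → K) i = 0) ({0} : Finset (Fin 4)) = {0} :=
      Finset.filter_true_of_mem fun _ _ => rfl
    rw [show (SA a F).exc = ({0} : Finset (Fin 4)) from rfl, hf]
    decide
  unfold CentreBlowup.step
  rw [hF, hr, he]; rfl

/-- **Step 2** (`x`-chart origin): `SB a F ⟶ SC a (TB F)`. [folklore] -/
theorem step_B [DecidableEq K] {a : ℕ} {F : MvPolynomial (Fin 4) K} (h : InvB a F) :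
    CentreBlowup.step 2 Finset.univ 0 0 (SB a F) = SC a (TB F) := by
  classical
  have hC := invC_TB h
  have hF : deletePthPowers 2 (pointTransform 2 Finset.univ 0 0 (SB a F)) = TB F := by
    rw [pointTransform, PointBlowup.translate_eq_self (0 : Fin 4 → K) (fun _ => rfl)]
    exact deletePthPowers_eq_self fun d hd => by
      obtain ⟨i, j, rfl⟩ := hC.1 d hd; rw [isPthPowerExponent_ex_iff]; omega
  have hr : newMult 2 Finset.univ 0 0 (SB a F) =
      Finsupp.single 0 (4 * a + 1) + Finsupp.single 1 (2 * a + 1) := by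
    unfold newMult
    rw [show (SB a F).F = F from rfl, ordAlong_B h, ENat.toNat_coe,
      show (SB a F).r = Finsupp.single 0 (2 * a) + Finsupp.single 1 (2 * a + 1) from rfl]
    ext i
    rw [Finsupp.update_apply, Finsupp.filter_apply]
    fin_cases i <;> simp
  have he : newExc 0 0 (SB a F) = ({0, 1} : Finset (Fin 4)) := by
    unfold newExc
    have hf : Finset.filter (fun i => (0 : Fin 4 → K) i = 0) ({0, 1} : Finset (Fin 4)) = {0, 1} :=
      Finset.filter_true_of_mem fun _ _ => rfl
    rw [show (SB a F).exc = ({0, 1} : Finset (Fin 4)) from rfl, hf]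
    decide
  unfold CentreBlowup.step
  rw [hF, hr, he]; rfl

/-- **Step 3** (`x`-chart at `y = 1`): `SC a F ⟶ SA (3a+1) (TC F)` — the component `y` is lost,
`x` gets `6a + 2`. [folklore] -/
theorem step_C [DecidableEq K] {a : ℕ} {F : MvPolynomial (Fin 4) K} (h : InvC a F) :
    CentreBlowup.step 2 Finset.univ 0 bY (SC a F) = SA (3 * a + 1) (TC F) := by
  classical
  have hr : newMult 2 Finset.univ 0 bY (SC a F) = Finsupp.single 0 (2 * (3 * a + 1)) := by
    unfold newMult
    rw [show (SC a F).F = F from rfl, ordAlong_C h, ENat.toNat_coe,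
      show (SC a F).r = Finsupp.single 0 (4 * a + 1) + Finsupp.single 1 (2 * a + 1) from rfl]
    ext i
    rw [Finsupp.update_apply, Finsupp.filter_apply]
    fin_cases i <;> simp [bY]; omega
  have he : newExc 0 bY (SC a F) = ({0} : Finset (Fin 4)) := by
    unfold newExc
    rw [show (SC a F).exc = ({0, 1} : Finset (Fin 4)) from rfl]
    ext i
    fin_cases i <;> simp [bY]
  unfold CentreBlowup.step
  rw [hr, he]; rfl

/-! ## 7. Edges and flags of the three steps -/

/-- every monomial of an `InvA/InvB/InvC` polynomial keeps `w²`. [folklore] -/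
theorem w_two_of_ex {F : MvPolynomial (Fin 4) K} {f g : ℕ → ℕ → ℕ}
    (h : ∀ d ∈ F.support, ∃ i j : ℕ, d = ex (f i j) (g i j)) : ∀ d ∈ F.support, d 2 = 2 := by
  intro d hd; obtain ⟨i, j, rfl⟩ := h d hd; simp

/-- **Edge 1 is a MODE-0 step**, DROP `3 → 2`. [folklore] -/
theorem step0_A [DecidableEq K] {a : ℕ} {F : MvPolynomial (Fin 4) K} (h : InvA a F) :
    Step0 2 (SA a F) (SB a (TA F)) ∧ DropD (SA a F) (SB a (TA F)) := by
  refine ⟨⟨?_, 1, 0, Finset.mem_univ _, rfl, isEquimultiplePoint_of_w (by decide) rfl (w_two_of_ex h.1), ?_,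
    (step_A h).symm⟩, ?_⟩
  · rw [show (SA a F).F = F from rfl, ordAlong_A h]; exact_mod_cast (by omega : 2 ≤ 2 * a + 3)
  · rw [step_A h]; exact fun h0 => (invB_TA h).2 (by rw [show TA F = 0 from h0, coeff_zero])
  · show (SB a (TA F)).shade < (SA a F).shade
    rw [shade_SA h, shade_SB (invB_TA h)]; exact_mod_cast (by norm_num : (2 : ℕ) < 3)

/-- **Edge 2 is a MODE-0 step**, EQUAL `2 → 2`. [folklore] -/
theorem step0_B [DecidableEq K] {a : ℕ} {F : MvPolynomial (Fin 4) K} (h : InvB a F) :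
    Step0 2 (SB a F) (SC a (TB F)) ∧ EqualD (SB a F) (SC a (TB F)) := by
  refine ⟨⟨?_, 0, 0, Finset.mem_univ _, rfl, isEquimultiplePoint_of_w (by decide) rfl (w_two_of_ex h.1), ?_,
    (step_B h).symm⟩, ?_⟩
  · rw [show (SB a F).F = F from rfl, ordAlong_B h]; exact_mod_cast (by omega : 2 ≤ 4 * a + 3)
  · rw [step_B h]; exact fun h0 => (invC_TB h).2 (by rw [show TB F = 0 from h0, coeff_zero])
  · show (SC a (TB F)).shade = (SB a F).shade
    rw [shade_SB h, shade_SC (invC_TB h)]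

/-- **Edge 3 is a MODE-0 step**, RISE `2 → 3` (characteristic `2`). [folklore] -/
theorem step0_C [CharP K 2] [DecidableEq K] {a : ℕ} {F : MvPolynomial (Fin 4) K} (h : InvC a F) :
    Step0 2 (SC a F) (SA (3 * a + 1) (TC F)) ∧ RiseD (SC a F) (SA (3 * a + 1) (TC F)) := by
  refine ⟨⟨?_, 0, bY, Finset.mem_univ _, rfl, isEquimultiplePoint_of_w (by decide) rfl (w_two_of_ex h.1), ?_,
    (step_C h).symm⟩, ?_⟩
  · rw [show (SC a F).F = F from rfl, ordAlong_C h]; exact_mod_cast (by omega : 2 ≤ 6 * a + 4)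
  · rw [step_C h]; exact fun h0 => (invA_TC h).2 (by rw [show TC F = 0 from h0, coeff_zero])
  · show (SC a F).shade < (SA (3 * a + 1) (TC F)).shade
    rw [shade_SC h, shade_SA (invA_TC h)]; exact_mod_cast (by norm_num : (2 : ℕ) < 3)

/-! ## 8. The period-start polynomials and the chain -/

/-- `aₙ`: `a₀ = 0`, `aₙ₊₁ = 3aₙ + 1` (so `2aₙ + 1 = 3ⁿ`). [folklore] -/
def aSeq : ℕ → ℕ
  | 0 => 0
  | n + 1 => 3 * aSeq n + 1

variable (K) in
/-- `Pₙ`: `P₀ = yw²`, `Pₙ₊₁ = TC (TB (TA Pₙ))` (one period of the MODE-0 word). [folklore] -/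
def P : ℕ → MvPolynomial (Fin 4) K
  | 0 => monomial (ex 0 1) 1
  | n + 1 => TC (TB (TA (P n)))

/-- the class root `yw²` is a period start with `a = 0`. [folklore] -/
theorem invA_zero : InvA 0 (P K 0) := by
  classical
  refine ⟨fun d hd => ⟨0, 0, ?_⟩, ?_⟩
  · have := support_monomial_subset hd
    rw [Finset.mem_singleton] at this; rw [this]
  · show coeff (ex (2 * 0) 1) (monomial (ex 0 1) (1 : K)) ≠ 0
    rw [coeff_monomial, if_pos (by norm_num)]; exact one_ne_zero

/-- every `Pₙ` is a period start with exponent `aₙ` (characteristic `2`). [folklore] -/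
theorem invA_P [CharP K 2] (n : ℕ) : InvA (aSeq n) (P K n) := by
  induction n with
  | zero => exact invA_zero
  | succ n ih => exact invA_TC (invC_TB (invB_TA ih))

variable (K) in
/-- **The chain** `c`: the MODE-0 word `[y-chart O · x-chart O · x-chart (y = 1)]^∞`. [folklore] -/
def chain (k : ℕ) : State K :=
  if k % 3 = 0 then SA (aSeq (k / 3)) (P K (k / 3))
  else if k % 3 = 1 then SB (aSeq (k / 3)) (TA (P K (k / 3)))
  else SC (aSeq (k / 3)) (TB (TA (P K (k / 3))))

/-- the chain at `3n`. [folklore] -/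
theorem chain_three_mul (n : ℕ) : chain K (3 * n) = SA (aSeq n) (P K n) := by
  unfold chain; rw [if_pos (by omega), show 3 * n / 3 = n by omega]
/-- the chain at `3n + 1`. [folklore] -/
theorem chain_three_mul_add_one (n : ℕ) : chain K (3 * n + 1) = SB (aSeq n) (TA (P K n)) := by
  unfold chain; rw [if_neg (by omega), if_pos (by omega), show (3 * n + 1) / 3 = n by omega]
/-- the chain at `3n + 2`. [folklore] -/
theorem chain_three_mul_add_two (n : ℕ) : chain K (3 * n + 2) = SC (aSeq n) (TB (TA (P K n))) := by
  unfold chain; rw [if_neg (by omega), if_neg (by omega), show (3 * n + 2) / 3 = n by omega]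
/-- the chain at `3n + 3` is the next period start. [folklore] -/
theorem chain_three_mul_add_three (n : ℕ) :
    chain K (3 * n + 3) = SA (3 * aSeq n + 1) (TC (TB (TA (P K n)))) := by
  rw [show 3 * n + 3 = 3 * (n + 1) by ring, chain_three_mul]; rfl

/-! ## 9. The theorem -/

/-- the three edges of period `n`. [folklore] -/
theorem period_edges [CharP K 2] [DecidableEq K] (n : ℕ) :
    (Step0 2 (chain K (3 * n)) (chain K (3 * n + 1)) ∧ DropD (chain K (3 * n)) (chain K (3 * n + 1))) ∧
    (Step0 2 (chain K (3 * n + 1)) (chain K (3 * n + 2)) ∧ EqualD (chain K (3 * n + 1)) (chain K (3 * n + 2))) ∧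
    (Step0 2 (chain K (3 * n + 2)) (chain K (3 * n + 3)) ∧ RiseD (chain K (3 * n + 2)) (chain K (3 * n + 3))) := by
  rw [chain_three_mul, chain_three_mul_add_one, chain_three_mul_add_two, chain_three_mul_add_three]
  exact ⟨step0_A (invA_P n), step0_B (invB_TA (invA_P n)), step0_C (invC_TB (invB_TA (invA_P n)))⟩

/-- every consecutive pair of the chain is a MODE-0 step. [folklore] -/
theorem chain_step0 [CharP K 2] [DecidableEq K] (k : ℕ) : Step0 2 (chain K k) (chain K (k + 1)) := by
  obtain ⟨n, r, hr, rfl⟩ : ∃ n r, r < 3 ∧ k = 3 * n + r := ⟨k / 3, k % 3, Nat.mod_lt _ (by norm_num),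
    (Nat.div_add_mod k 3).symm⟩
  have h := period_edges (K := K) n
  interval_cases r
  · exact h.1.1
  · exact h.2.1.1
  · exact h.2.2.1

end Mode0Umbrella

open Mode0Umbrella in
/-- **C-001 ‖ K.**  Over every field of characteristic `2` there is an infinite chain of MODE-0
(point blow-up) steps in class (4,1) along which the residual order `d` DROPS (`3 → 2`), stays EQUAL,
and RISES (`2 → 3`) with period `3` — in particular `d` rises infinitely often while staying bounded:
the Whitney-umbrella cylinder `z² + yw²` under the word `[y-chart O · x-chart O · x-chart (y = 1)]^∞`
(Hauser–Perlega PRIMS 60 §7 Ex. 2, «the initial form returns»; JUMPS C-001, zoo Z28; cleaned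
polynomials `x^{2aₙ}·y·w²·Rₙ²`, `aₙ₊₁ = 3aₙ + 1`).  Census value; nothing about resolution of
singularities. [folklore] -/
theorem exists_mode0_chain_rising_infinitely_often (K : Type) [Field K] [CharP K 2] [DecidableEq K] :
    ∃ c : ℕ → State K, (∀ k, Step0 2 (c k) (c (k + 1))) ∧ (∀ n, DropD (c (3 * n)) (c (3 * n + 1))) ∧
      (∀ n, EqualD (c (3 * n + 1)) (c (3 * n + 2))) ∧ ∀ n, RiseD (c (3 * n + 2)) (c (3 * n + 3)) :=
  ⟨chain K, chain_step0, fun n => (period_edges n).1.2, fun n => (period_edges n).2.1.2,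
    fun n => (period_edges n).2.2.2⟩

open Mode0Umbrella in
/-- In particular over `𝔽₂`: infinitely many RISE:d edges on ONE MODE-0 branch of class (4,1). [folklore] -/
theorem exists_mode0_chain_riseD_unbounded_two :
    ∃ c : ℕ → State (ZMod 2), (∀ k, Step0 2 (c k) (c (k + 1))) ∧ ∀ N, ∃ k, N ≤ k ∧ RiseD (c k) (c (k + 1)) := by
  obtain ⟨c, hc, -, -, hr⟩ := exists_mode0_chain_rising_infinitely_often (ZMod 2)
  exact ⟨c, hc, fun N => ⟨3 * N + 2, by omega, hr N⟩⟩

end Summit.ResolutionOfSingularities.ResolutionOfSingularities.Theorems.PIDim4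

end
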